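import Summits.ResolutionOfSingularities.ResolutionOfSingularities.Theses.FrobeniusClosing
import Summits.ResolutionOfSingularities.ResolutionOfSingularities.Theorems.FrobeniusClosingSteerWords01Core

/-!
# Crux `Steer` (stmt-ResolutionOfSingularities-16345), line `switching-dichotomy` — WORDS 02: the stub STATEMENTS by name `Sig.*`
(HOIST of the registered skeleton r31 727d9e199382098a, l.422–676)

Holder res-L0-w41-lead-1 g4 on res-L0-w41-plan-1 RULING 47 (E1); see `…Words01Core` for the hoist protocol. This module is the skeleton's
section «The stub STATEMENTS by name» byte for byte: the eleven `Sig.stub_*` propositions (`Sig.stub_cp2019General` is one of the six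
REGISTERED stubs' types; the skeleton keeps proving `theorem stub_cp2019General : Sig.stub_cp2019General` itself). Imports the route file
only for `IsolatedForcedTermination` (consumed by `Sig.stub_steerDefectCore4` and its core cuts). Nothing here is a statement of the
manuscript [claim: Hironaka2017, status: under-review]. OURS (candidates / vocabulary; AI review is weaker than expert review). GATE NOTE: the CLOSED `def … : Prop` statements below carry
their references as «(ref. Key, locator)» / «(folklore)» instead of `[cite: …]` / `[folklore]` tags — a `[cite]`d closed Prop in a Theorems file is RELOCATED to Literature by the gate
(docs/handoff/gate.md «Relocation»), and these are OURS obligations / plan words, not published facts.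
-/

open Summit.ResolutionOfSingularities.ResolutionOfSingularities.Theses.FrobeniusClosing (IsolatedForcedTermination)
open Literature.AlgebraicGeometry.Resolution (IsAbhyankarPlace FGOver exists_ringKrullDim_eq_and_trdeg_eq
  trdeg_eq_trdeg_of_isFractionRing locAtCentre IsQuadraticTransformAlong SubringDominates IsRsopPart
  LocalUniformization3 RelLocalUniformization CossartPiltant2019General)
open Summit.ResolutionOfSingularities.ResolutionOfSingularities.Theorems.SteerRankThinness
  (HasProperCoarsening concl_of_hasProperCoarsening rankOne_of_not_hasProperCoarsening)

set_option linter.dupNamespace false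

namespace Summit.ResolutionOfSingularities.ResolutionOfSingularities.Theorems.SwitchingDichotomy.Words

/-! ## The stub STATEMENTS by name -/

/-- Statement of `stub_zeroDimPerfect` (= line `birth`'s `stub_zeroDimReduction`; LANDED p166845). -/
def Sig.stub_zeroDimPerfect : Prop :=
  ∀ p : ℕ, p.Prime → TorsorLUZeroDim p → TorsorLU p

/-- Statement of `stub_switchingDefectless` (r4 form; LANDED p169091 as
`Theorems.SwitchingDichotomy.switchingDefectlessSeq`): strongly switching + parameter-archimedean +
defectless ⇒ conclusion, any ground field, every dimension. -/
def Sig.stub_switchingDefectless : Prop :=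
  ∀ p : ℕ, p.Prime → ∀ (k K : Type) [Field k] [CharP k p] [Field K] [Algebra k K]
    (O : ValuationSubring K) (A₀ : Subalgebra k K) (h₀ : A₀.toSubring ≤ O.toSubring) (t : K),
    A₀.FG → t ^ p ∈ A₀ → IsFractionRing (Algebra.adjoin k (insert t (A₀ : Set K))) K →
    IsRegularLocalRing (Localization.AtPrime
      (Ideal.comap (Subring.inclusion h₀) (IsLocalRing.maximalIdeal O))) →
    StronglySwitching O A₀ → ArchSeq O A₀ → ¬ Defect O A₀ t p → Concl O A₀ t

/-- Statement of `stub_lu3Perfect` (reshape r7): **local uniformization in dimension `≤ 3` over PERFECT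
ground fields of characteristic `p`** — for every perfect field `k` of characteristic `p`, every valuation ring
`O` of a field `K ⊇ k` and every finitely generated `A ⊆ O` with `Frac A = K` and `dim A ≤ 3`, some finitely
generated `A ⊆ A' ⊆ O` is regular at the centre of `O` (the tree's `LocalUniformization3 k`). KNOWN IN PRINT
(Cossart–Piltant 2008/2009 Main Theorem for `k` differentially finite over a perfect field; Cossart–Piltant 2019
Thm. 1.1 with §4.1 (LU) over every field) and one line from the tree's NAMED FACT `CossartPiltant2019LU3`
(`stub_lu3Perfect_of_cossartPiltant2019LU3` below); unproved in the tree = a formalization debt.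
(ref. CossartPiltant2019, Thm. 1.1 with §4.1 (LU)) (ref. CossartPiltant2009, Main Theorem) -/
def Sig.stub_lu3Perfect : Prop :=
  ∀ p : ℕ, p.Prime → ∀ (k : Type) [Field k] [CharP k p] [PerfectField k], LocalUniformization3.{0} k

/-- Statement of `stub_cp2019General` (reshape r15): **Cossart–Piltant 2019, Thm. 1.1 as printed** — every reduced
separated Noetherian quasi-excellent scheme of dimension `≤ 3` has a resolution which is an isomorphism over the regular
locus (the tree's NAMED FACT `Literature.AlgebraicGeometry.Resolution.CossartPiltant2019General`, unproved there: a
formalization debt, not an open problem). It carries BOTH uses of Cossart–Piltant in this skeleton: local uniformization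
in dimension `≤ 3` (`stub_lu3Perfect`, through `CossartPiltant2019General.cossartPiltant2019'` and `CossartPiltant2019.lu3`)
and the composite-rank discharge at `n = 4` (res-L0-w41-idea-1's `concl_of_hasProperCoarsening`).
(ref. CossartPiltant2019, Thm. 1.1) -/
def Sig.stub_cp2019General : Prop :=
  CossartPiltant2019General.{0}

/-- Statement of `stub_steerDefectCore4` (reshape r7): **the dimension-`≥ 4` defect core of `Steer`** — the
parent crux's registered core F⁹ (`stub_defectCoreFinal` of
`Cruxes/LuAlphaPTorsor/Lines/pfaff_line_log_final_forms.lean`: zero-dimensional NON-Abhyankar valuation at a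
closed-point centre of dimension `≥ 3` of the regular base, NOT dense in any finitely generated Abhyankar
subfunction field, not discrete of rank one, no unit `ℤ`-derivative of `t ^ p`, `t ^ p` not a `p`-th power at the
centre) restricted to PERFECT ground fields, intersected with the complement of this line's landed range
(¬ (strongly switching ∧ parameter-archimedean ∧ defectless)), handed the antecedent, torsor LU at all
zero-dimensional valuations in transcendence degree `< n`, and — new in r7 — `trdeg = n ≥ 4` (the r6 core had
`n ≥ 3`; `n = 3` is `stub_lu3Perfect`). Verbatim an instance of the catalogued barrier
`Literature.Barriers.ResolutionOfSingularities.DimensionFourFrontier`. -/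
def Sig.stub_steerDefectCore4 : Prop :=
  IsolatedForcedTermination → ∀ p : ℕ, p.Prime → ∀ n : ℕ, 4 ≤ n → TorsorLUZeroDimBelow p n →
    ∀ (k K : Type) [Field k] [CharP k p] [PerfectField k] [Field K] [Algebra k K]
    (O : ValuationSubring K) (A₀ : Subalgebra k K) (h₀ : A₀.toSubring ≤ O.toSubring) (t : K),
    A₀.FG → ∀ (htp : t ^ p ∈ A₀), IsFractionRing (Algebra.adjoin k (insert t (A₀ : Set K))) K →
    IsRegularLocalRing (Localization.AtPrime
      (Ideal.comap (Subring.inclusion h₀) (IsLocalRing.maximalIdeal O))) →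
    (Ideal.comap (Subring.inclusion h₀) (IsLocalRing.maximalIdeal O)).IsMaximal →
    ZeroDim k O →
    ¬ ringKrullDim (Localization.AtPrime
      (Ideal.comap (Subring.inclusion h₀) (IsLocalRing.maximalIdeal O))) ≤ 2 →
    ¬ IsAbhyankarPlace O (algebraMap k K).fieldRange ⊤ →
    ¬ DenseAbhyankar k O →
    ¬ Discrete O →
    (∀ δ : Derivation ℤ (Localization.AtPrime (Ideal.comap (Subring.inclusion h₀)
        (IsLocalRing.maximalIdeal O))) (Localization.AtPrime (Ideal.comap (Subring.inclusion h₀)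
        (IsLocalRing.maximalIdeal O))),
      ¬ IsUnit (δ (algebraMap A₀.toSubring (Localization.AtPrime (Ideal.comap (Subring.inclusion h₀)
        (IsLocalRing.maximalIdeal O))) ⟨t ^ p, htp⟩))) →
    (∀ c : Localization.AtPrime (Ideal.comap (Subring.inclusion h₀) (IsLocalRing.maximalIdeal O)),
      algebraMap A₀.toSubring (Localization.AtPrime (Ideal.comap (Subring.inclusion h₀)
        (IsLocalRing.maximalIdeal O))) ⟨t ^ p, htp⟩ ≠ c ^ p) →
    Algebra.trdeg k K = (n : Cardinal) →
    ¬ (StronglySwitching O A₀ ∧ ArchSeq O A₀ ∧ ¬ Defect O A₀ t p) → Concl O A₀ t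

/-! ### r8: the cut of the core by the behaviour of the greedy torsor run (W4.1, C2) -/

/-- `stub_core4RunTrichotomy` — **PROVABLE (S/M; bookkeeping + greedy recursion).** For a datum regular at a
centre of dimension `≥ 3` (so the centre is a non-zero ideal and the quadratic sequence of the base along `O`
exists, `stub_switchingSetup`), the GREEDY torsor run (extend by a strict-transform step as long as one lands
with `p`-th power in the next member) is eternal, or reaches a stage in order-one form, or stalls at a stage
that is neither steppable nor of order one (cleaned order in `[2, p - 1]`). First move: `stub_switchingSetup`
with `a ∈ 𝔪_O ∩ A₀`, `a ≠ 0` from `¬ dim ≤ 2`; then dependent choice. (folklore) -/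
def Sig.stub_core4RunTrichotomy : Prop :=
  ∀ (p : ℕ) (k K : Type) [Field k] [Field K] [Algebra k K]
    (O : ValuationSubring K) (A₀ : Subalgebra k K) (h₀ : A₀.toSubring ≤ O.toSubring) (t : K),
    t ^ p ∈ A₀ →
    IsRegularLocalRing (Localization.AtPrime
      (Ideal.comap (Subring.inclusion h₀) (IsLocalRing.maximalIdeal O))) →
    ¬ ringKrullDim (Localization.AtPrime
      (Ideal.comap (Subring.inclusion h₀) (IsLocalRing.maximalIdeal O))) ≤ 2 →
    ∃ R : ℕ → Subring K, R 0 = locAtCentre A₀.toSubring O ∧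
      (∀ i, IsQuadraticTransformAlong O (R i) (R (i + 1))) ∧
      ((∃ s : ℕ → K, IsTorsorRun O R t p s) ∨
        (∃ (s : ℕ → K) (N : ℕ), IsTorsorRunUpTo O R t p s N ∧ OrderOneAt R p s N) ∨
        (∃ (s : ℕ → K) (N : ℕ), IsTorsorRunUpTo O R t p s N ∧ ¬ CanStep O R p s N ∧
          ¬ OrderOneAt R p s N))

/-- `stub_core4Dictionary` — **PROVABLE (XL; the chain's owned lever: `hT` CONSUMED).** Along a
zero-dimensional valuation ring `O` over a PERFECT field, over a base regular at the (closed-point) centre,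
an ETERNAL torsor run is NON-ISOLATED at infinitely many stages. Proof plan (the valuation-run dictionary):
`R i` is regular, essentially of finite type over `k`, with residue field `κ_i ⊆ κ_O` algebraic over `k`, hence
perfect; Cohen coordinates of `R̂ i` FORCED by the run (`u_j ↦ u_j / x - [τ_j]`, `[τ_j]` the coefficient-field
representative of the residue of `u_j / x`) conjugate the strict-transform step to the typed `step` (chart =
an index `j` with `u_j / x` a unit, translation `τ`), up to the torsor gauge `f ↦ w ^ p * f + h ^ p` (`w` a
unit), under which the typed `Isol` and `MultP` are invariant; `Der_ℤ (R i)` is free on `∂/∂u_j` (perfect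
ground field, separable algebraic residue field), so `IsolAt` = typed `Isol`, and `CanStep` with cleaned
series `≠ 0` = typed `MultP`; if the cleaned series vanishes at some stage the Jacobian ideal is `0` from there
on; otherwise `hT` (over `κ = κ_O^alg`, restarted at `i₀`) forbids `Isol` at all stages `≥ i₀`.
(ref. HauserPerlega2019, §§2–3) (ref. Matsumura1987, Thms. 28.3, 30.6) (folklore) -/
def Sig.stub_core4Dictionary : Prop :=
  IsolatedForcedTermination → ∀ p : ℕ, p.Prime →
    ∀ (k K : Type) [Field k] [CharP k p] [PerfectField k] [Field K] [Algebra k K]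
    (O : ValuationSubring K) (A₀ : Subalgebra k K) (h₀ : A₀.toSubring ≤ O.toSubring) (t : K),
    A₀.FG → t ^ p ∈ A₀ → IsFractionRing (Algebra.adjoin k (insert t (A₀ : Set K))) K →
    IsRegularLocalRing (Localization.AtPrime
      (Ideal.comap (Subring.inclusion h₀) (IsLocalRing.maximalIdeal O))) →
    ZeroDim k O →
    ∀ R : ℕ → Subring K, R 0 = locAtCentre A₀.toSubring O →
      (∀ i, IsQuadraticTransformAlong O (R i) (R (i + 1))) →
      ∀ s : ℕ → K, IsTorsorRun O R t p s → ∀ i₀ : ℕ, ∃ i, i₀ ≤ i ∧ ¬ IsolAt O (R i) (s i ^ p)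

/-- `stub_core4OrderOneExit` — **PROVABLE (S/M; the order-one exit).** If a torsor run reaches a stage `N`
in order-one form — `(s N) ^ p - g ^ p = z` with `z` a regular parameter of `R N` — then `R N [s N]` is
regular at the centre of `O` (`T ^ p - g ^ p - z ∉ 𝔑 ²` for the unique maximal `𝔑 = (𝔪_N, T - g)` over
`𝔪_N`), and re-basing the datum on a finitely generated model of `R N` containing `∏_{i<N} x_i`, the
accumulated cleaner and `g` (as in `exists_model_of_sequence_member`, `stub_switchingExit`) gives the
regular model: `t = (∏ x_i) * s N + G`. (ref. HeinzerEtAl2015, Prop. 4.4) (folklore) -/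
def Sig.stub_core4OrderOneExit : Prop :=
  ∀ p : ℕ, p.Prime → ∀ (k K : Type) [Field k] [CharP k p] [Field K] [Algebra k K]
    (O : ValuationSubring K) (A₀ : Subalgebra k K) (h₀ : A₀.toSubring ≤ O.toSubring) (t : K),
    A₀.FG → t ^ p ∈ A₀ → IsFractionRing (Algebra.adjoin k (insert t (A₀ : Set K))) K →
    IsRegularLocalRing (Localization.AtPrime
      (Ideal.comap (Subring.inclusion h₀) (IsLocalRing.maximalIdeal O))) →
    ∀ R : ℕ → Subring K, R 0 = locAtCentre A₀.toSubring O →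
      (∀ i, IsQuadraticTransformAlong O (R i) (R (i + 1))) →
      ∀ (s : ℕ → K) (N : ℕ), IsTorsorRunUpTo O R t p s N → OrderOneAt R p s N → Concl O A₀ t

/-- `stub_core4LowMult` — **FRONTIER-class residual R1 (open problem for `p ≥ 3`; EMPTY, hence provable, for
`p = 2`).** The dimension-`≥ 4` defect core of `Steer` (every hypothesis of `Sig.stub_steerDefectCore4` kept
verbatim, WITHOUT the antecedent) restricted to data whose greedy torsor run STALLS at a stage `N` that is
neither steppable nor of order one: after cleaning, the radicand `(s N) ^ p` has order `ν` with
`2 ≤ ν ≤ p - 1` in `R N` (`ν ≥ 1` always, the residue field being perfect; `ν = 1` is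
`stub_core4OrderOneExit`; `ν ≥ p` is `CanStep`). Here the base-point dynamics of `IsolatedForcedTermination`
is silent (its step degenerates to the total transform) and the hypersurface `T ^ p = (s N) ^ p` has
multiplicity `ν < p`: maximal contact exists for the initial form but the induction lands in resolution of
marked ideals in dimension `n ≥ 4`, characteristic `p` —
`Literature.Barriers.ResolutionOfSingularities.DimensionFourFrontier`. Inhabited for `p ≥ 3` by the K4.1b
datum `t ^ p = y₁ y₂ + y₃ ^ (p + 1)` (order `2`, stalled at `N = 0`). Why it might fail as a PLAN: no invariant is known to drop for multiplicity-`< p`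
purely inseparable hypersurfaces in dimension `≥ 5` (ambient); the statement itself is implied by `Steer`.
(ref. CossartPiltant2019, Rem. 3.2) (arXiv:1412.7697 §7) (ref. CutkoskyMourtada2019, Thm. 7.1) -/
def Sig.stub_core4LowMult : Prop :=
  ∀ p : ℕ, p.Prime → ∀ n : ℕ, 4 ≤ n → TorsorLUZeroDimBelow p n →
    ∀ (k K : Type) [Field k] [CharP k p] [PerfectField k] [Field K] [Algebra k K]
    (O : ValuationSubring K) (A₀ : Subalgebra k K) (h₀ : A₀.toSubring ≤ O.toSubring) (t : K),
    A₀.FG → ∀ (htp : t ^ p ∈ A₀), IsFractionRing (Algebra.adjoin k (insert t (A₀ : Set K))) K →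
    IsRegularLocalRing (Localization.AtPrime
      (Ideal.comap (Subring.inclusion h₀) (IsLocalRing.maximalIdeal O))) →
    (Ideal.comap (Subring.inclusion h₀) (IsLocalRing.maximalIdeal O)).IsMaximal →
    ZeroDim k O →
    ¬ ringKrullDim (Localization.AtPrime
      (Ideal.comap (Subring.inclusion h₀) (IsLocalRing.maximalIdeal O))) ≤ 2 →
    ¬ IsAbhyankarPlace O (algebraMap k K).fieldRange ⊤ →
    ¬ DenseAbhyankar k O →
    ¬ Discrete O →
    (∀ δ : Derivation ℤ (Localization.AtPrime (Ideal.comap (Subring.inclusion h₀)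
        (IsLocalRing.maximalIdeal O))) (Localization.AtPrime (Ideal.comap (Subring.inclusion h₀)
        (IsLocalRing.maximalIdeal O))),
      ¬ IsUnit (δ (algebraMap A₀.toSubring (Localization.AtPrime (Ideal.comap (Subring.inclusion h₀)
        (IsLocalRing.maximalIdeal O))) ⟨t ^ p, htp⟩))) →
    (∀ c : Localization.AtPrime (Ideal.comap (Subring.inclusion h₀) (IsLocalRing.maximalIdeal O)),
      algebraMap A₀.toSubring (Localization.AtPrime (Ideal.comap (Subring.inclusion h₀)
        (IsLocalRing.maximalIdeal O))) ⟨t ^ p, htp⟩ ≠ c ^ p) →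
    Algebra.trdeg k K = (n : Cardinal) →
    ¬ (StronglySwitching O A₀ ∧ ArchSeq O A₀ ∧ ¬ Defect O A₀ t p) →
    ∀ R : ℕ → Subring K, R 0 = locAtCentre A₀.toSubring O →
      (∀ i, IsQuadraticTransformAlong O (R i) (R (i + 1))) →
      ∀ (s : ℕ → K) (N : ℕ), IsTorsorRunUpTo O R t p s N → ¬ CanStep O R p s N →
        ¬ OrderOneAt R p s N → Concl O A₀ t

/-- Statement of `stub_core4LowMultOdd` (reshape r12; parity split of R1 endorsed by CHAIN v4.4 §B): the stalled
core `stub_core4LowMult` for ODD `p` only — at `p = 2` the stall regime is EMPTY and proved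
(`Theorems.SwitchingDichotomy.LowMult.core4LowMult_two`, res-L0-w41-stub-2, p481401). `DimensionFourFrontier` verbatim
(LU of a multiplicity-`ν` hypersurface, `2 ≤ ν < p`, along a zero-dimensional valuation, ambient dimension `≥ 5`).
(ref. CossartPiltant2019, Rem. 3.2) (ref. CutkoskyMourtada2019, Thm. 7.1) -/
def Sig.stub_core4LowMultOdd : Prop :=
  ∀ p : ℕ, p.Prime → p ≠ 2 → ∀ n : ℕ, 4 ≤ n → TorsorLUZeroDimBelow p n →
    ∀ (k K : Type) [Field k] [CharP k p] [PerfectField k] [Field K] [Algebra k K]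
    (O : ValuationSubring K) (A₀ : Subalgebra k K) (h₀ : A₀.toSubring ≤ O.toSubring) (t : K),
    A₀.FG → ∀ (htp : t ^ p ∈ A₀), IsFractionRing (Algebra.adjoin k (insert t (A₀ : Set K))) K →
    IsRegularLocalRing (Localization.AtPrime
      (Ideal.comap (Subring.inclusion h₀) (IsLocalRing.maximalIdeal O))) →
    (Ideal.comap (Subring.inclusion h₀) (IsLocalRing.maximalIdeal O)).IsMaximal →
    ZeroDim k O →
    ¬ ringKrullDim (Localization.AtPrime
      (Ideal.comap (Subring.inclusion h₀) (IsLocalRing.maximalIdeal O))) ≤ 2 →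
    ¬ IsAbhyankarPlace O (algebraMap k K).fieldRange ⊤ →
    ¬ DenseAbhyankar k O →
    ¬ Discrete O →
    (∀ δ : Derivation ℤ (Localization.AtPrime (Ideal.comap (Subring.inclusion h₀)
        (IsLocalRing.maximalIdeal O))) (Localization.AtPrime (Ideal.comap (Subring.inclusion h₀)
        (IsLocalRing.maximalIdeal O))),
      ¬ IsUnit (δ (algebraMap A₀.toSubring (Localization.AtPrime (Ideal.comap (Subring.inclusion h₀)
        (IsLocalRing.maximalIdeal O))) ⟨t ^ p, htp⟩))) →
    (∀ c : Localization.AtPrime (Ideal.comap (Subring.inclusion h₀) (IsLocalRing.maximalIdeal O)),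
      algebraMap A₀.toSubring (Localization.AtPrime (Ideal.comap (Subring.inclusion h₀)
        (IsLocalRing.maximalIdeal O))) ⟨t ^ p, htp⟩ ≠ c ^ p) →
    Algebra.trdeg k K = (n : Cardinal) →
    ¬ (StronglySwitching O A₀ ∧ ArchSeq O A₀ ∧ ¬ Defect O A₀ t p) →
    ∀ R : ℕ → Subring K, R 0 = locAtCentre A₀.toSubring O →
      (∀ i, IsQuadraticTransformAlong O (R i) (R (i + 1))) →
      ∀ (s : ℕ → K) (N : ℕ), IsTorsorRunUpTo O R t p s N → ¬ CanStep O R p s N →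
        ¬ OrderOneAt R p s N → Concl O A₀ t

/-- `stub_core4EternalNonIsolated` — **FRONTIER-class residual R2 (open problem).** The dimension-`≥ 4`
defect core of `Steer` (every hypothesis of `Sig.stub_steerDefectCore4` kept verbatim, WITHOUT the antecedent)
restricted to data with an ETERNAL torsor run that is NON-ISOLATED at infinitely many stages — all that
`IsolatedForcedTermination` leaves of the eternal (defect) regime once `stub_core4Dictionary` has read the run
as its point dynamics: the Jacobian ideal of the cleaned radicand fails to be `𝔪`-primary again and again, i.e.
the singular locus of the strict transform `T ^ p = (s i) ^ p` keeps a positive-dimensional component through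
the centre of `O`. This is the non-isolated half of the defect frontier of local uniformization in dimension
`≥ 4` (`Literature.Barriers.ResolutionOfSingularities.DimensionFourFrontier`); the natural next lever is a
permissible centre INSIDE the non-isolated singular locus (equimultiple curve/surface blow-ups, not point
blow-ups), for which no termination invariant is on record in characteristic `p`. Why it might fail as a PLAN:
eternal non-isolated runs with defect exist in every dimension `≥ 3` candidate family `t ^ p = y₁ y₂ ^ p + …`
(non-vacuity is chain question K4.1c); the statement itself is implied by `Steer`.
(ref. HeinzerEtAl2015, Discussion 4.2) (ref. Kuhlmann2010ArtinSchreier, §2) (ref. HauserPerlega2019, §3)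
(ref. CutkoskyMourtada2019, Thm. 7.1) -/
def Sig.stub_core4EternalNonIsolated : Prop :=
  ∀ p : ℕ, p.Prime → ∀ n : ℕ, 4 ≤ n → TorsorLUZeroDimBelow p n →
    ∀ (k K : Type) [Field k] [CharP k p] [PerfectField k] [Field K] [Algebra k K]
    (O : ValuationSubring K) (A₀ : Subalgebra k K) (h₀ : A₀.toSubring ≤ O.toSubring) (t : K),
    A₀.FG → ∀ (htp : t ^ p ∈ A₀), IsFractionRing (Algebra.adjoin k (insert t (A₀ : Set K))) K →
    IsRegularLocalRing (Localization.AtPrime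
      (Ideal.comap (Subring.inclusion h₀) (IsLocalRing.maximalIdeal O))) →
    (Ideal.comap (Subring.inclusion h₀) (IsLocalRing.maximalIdeal O)).IsMaximal →
    ZeroDim k O →
    ¬ ringKrullDim (Localization.AtPrime
      (Ideal.comap (Subring.inclusion h₀) (IsLocalRing.maximalIdeal O))) ≤ 2 →
    ¬ IsAbhyankarPlace O (algebraMap k K).fieldRange ⊤ →
    ¬ DenseAbhyankar k O →
    ¬ Discrete O →
    (∀ δ : Derivation ℤ (Localization.AtPrime (Ideal.comap (Subring.inclusion h₀)
        (IsLocalRing.maximalIdeal O))) (Localization.AtPrime (Ideal.comap (Subring.inclusion h₀)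
        (IsLocalRing.maximalIdeal O))),
      ¬ IsUnit (δ (algebraMap A₀.toSubring (Localization.AtPrime (Ideal.comap (Subring.inclusion h₀)
        (IsLocalRing.maximalIdeal O))) ⟨t ^ p, htp⟩))) →
    (∀ c : Localization.AtPrime (Ideal.comap (Subring.inclusion h₀) (IsLocalRing.maximalIdeal O)),
      algebraMap A₀.toSubring (Localization.AtPrime (Ideal.comap (Subring.inclusion h₀)
        (IsLocalRing.maximalIdeal O))) ⟨t ^ p, htp⟩ ≠ c ^ p) →
    Algebra.trdeg k K = (n : Cardinal) →
    ¬ (StronglySwitching O A₀ ∧ ArchSeq O A₀ ∧ ¬ Defect O A₀ t p) →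
    ∀ R : ℕ → Subring K, R 0 = locAtCentre A₀.toSubring O →
      (∀ i, IsQuadraticTransformAlong O (R i) (R (i + 1))) →
      ∀ s : ℕ → K, IsTorsorRun O R t p s → (∀ i₀ : ℕ, ∃ i, i₀ ≤ i ∧ ¬ IsolAt O (R i) (s i ^ p)) →
        Concl O A₀ t


end Summit.ResolutionOfSingularities.ResolutionOfSingularities.Theorems.SwitchingDichotomy.Words
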